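import Summits.QuantumAdvantage.QuantumAdvantage.Theses.CubicForrelation
import Summits.QuantumAdvantage.QuantumAdvantage.Theorems.NearExactIsExact.Negative.CapTightTwelve
import Summits.QuantumAdvantage.QuantumAdvantage.Theorems.NearExactIsExact.Negative.ProductFourteen

/-!
# Level six of the `n = 14` Walsh tower is inhabited at capacity `119/128` (negative-side certificate for `NearExactIsExact`)

Negative-side support for `NearExactIsExact` (stmt-QuantumAdvantage-14043; B2b disprover seat `b2b-cforr-disprove`, generation 5,
2026-08-19).  HONEST FRAMING: the value of this file is a CERTIFICATE (an exactly evaluated Walsh spectrum statistic of one explicit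
cubic), not summit progress.

The proved isolation bound at `n = 14` (`isolation_fourteen`: `Φ(f,g) = 1 ∨ Φ(f,g) ≤ 31/32`) runs the Walsh tower at levels
`5, 6, 7`; the constant `31/32` comes from levels `5` and `6` (a Walsh coefficient `≢ 0 (mod 128)`), while level `7` alone would give
`15/16`.  All bounds of that file are ONE-SIDED (`forrelation_le_cap`: `Φ(f,g)·2^21 ≤ Σ_y |W_g(y)|`).  The known NON-exact values at
`n = 14` are `≤ 57/64` (`ProductFourteen`), so the window `(57/64, 31/32]` is open, and any attempt to shrink it from above by capacity
alone must bound the capacity of the cubics `g` having a Walsh coefficient `≡ 64 (mod 128)` ("level 6, case B").  This file shows that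
this class is inhabited at capacity `119/128 = 0.9297 > 57/64`:
the `56`-monomial cubic `gL` below (found by the seat's structured search `g5/oddsearch.c` + `g5/rsparse.c`) has
`W_gL(0) = 64` and `Σ_y |W_gL(y)| = (119/128)·2^21 = 1949696` (`|W_gL| ∈ {64 (5376×), 128 (8192×), 192 (2688×), 320 (128×)}`,
no Walsh zeros).  Consequently the capacity method cannot certify `Φ ≤ 57/64` (nor anything below `119/128`) on level 6; it
COULD still certify `15/16` there — no level-6 cubic of capacity `≥ 15/16` was found (see the seat's DISPROOF.md §12 for the search
and for the fibre calculus behind it).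

STRUCTURE of `gL` (almost-Maiorana–McFarland, `s = 6`): `gL(x ‖ z) = x·ρ(z) ⊕ r(z)` with `x ∈ 𝔽₂⁶` (bits `0–5`), `z ∈ 𝔽₂⁸`
(bits `6–13`), `ρ : 𝔽₂⁸ → 𝔽₂⁶` quadratic with fibre profile `16` fibres of size `3`, `32` affine `2`-flats, `16` fibres of size `5`
(eight of them a `2`-flat plus a point), and `r = z₀z₃ ⊕ z₁z₄ ⊕ z₀z₂z₅ ⊕ z₃z₄z₅ ⊕ z₃z₅z₆` realising the sign-optimal value on every
fibre; `W_gL(α ‖ β) = 64 Σ_{z ∈ ρ⁻¹(α)} (-1)^{r(z) ⊕ β·z}`, so `Σ|W_gL| = 64·(16·384 + 32·512 + 8·512 + 8·480) = 64·30464`.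

`native_decide` evaluates the fast Walsh–Hadamard transform `SmallCases.wal`: the file is `computational`.
References: Carlet 2021 §6.1 (Maiorana–McFarland class); Aaronson–Ambainis 2018 §1.1.1 (forrelation).
-/

set_option linter.dupNamespace false -- D-0017: single-problem summit ⇒ `QuantumAdvantage.QuantumAdvantage` by design

namespace Summit.QuantumAdvantage.QuantumAdvantage.Theorems.NearExactIsExact.Negative.LevelSixFourteen

open Finset
open Literature.Computability.QuantumComplexity
open Literature.Computability.QuantumComplexity.DerivativeWalsh (W)
open Summit.QuantumAdvantage.QuantumAdvantage.Theorems.SignedExactSliceIsLift.StubMoebius (isDegLeFun_xor)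
open Summit.QuantumAdvantage.QuantumAdvantage.Theorems.NearExactIsExact.Negative.SmallCases
  (wal sigTable wspec pt sum_pt W_pt wal_sigTable)
open Summit.QuantumAdvantage.QuantumAdvantage.Theorems.NearExactIsExact.Negative.CapTight (sum_abs_wspec_eq)
open Summit.QuantumAdvantage.QuantumAdvantage.Theorems.NearExactIsExact.Negative.ProductFourteen
  (isDegLeFun_mon3 isDegLeFun_mon2)

/-- `gL(x ‖ z) = x·ρ(z) ⊕ r(z)`, in algebraic normal form (`56` monomials; bits `0–5` = `x`, bits `6–13` = `z`).
[cite: Carlet2020, §6.1] -/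
def gL (x : Fin (7 + 7) → Bool) : Bool :=
  xor
    (xor
      (xor
        (xor
          (xor (x 1 && x 6) (xor (x 4 && x 6) (x 2 && x 7)))
          (xor (xor (x 5 && x 7) (x 5 && (x 6 && x 7))) (xor (x 0 && x 8) (x 1 && x 8))))
        (xor
          (xor (x 4 && x 8) (xor (x 5 && x 8) (x 1 && x 9)))
          (xor (xor (x 5 && x 9) (x 6 && x 9)) (xor (x 5 && (x 7 && x 9)) (x 5 && (x 8 && x 9))))))
      (xor
        (xor
          (xor (x 0 && x 10) (xor (x 4 && x 10) (x 5 && x 10)))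
          (xor
            (xor (x 5 && (x 6 && x 10)) (x 7 && x 10))
            (xor (x 5 && (x 7 && x 10)) (x 4 && (x 8 && x 10)))))
        (xor
          (xor (x 5 && (x 8 && x 10)) (xor (x 1 && x 11) (x 4 && x 11)))
          (xor
            (xor (x 5 && x 11) (x 5 && (x 7 && x 11)))
            (xor (x 4 && (x 8 && x 11)) (x 6 && (x 8 && x 11)))))))
    (xor
      (xor
        (xor
          (xor (x 5 && (x 10 && x 11)) (xor (x 9 && (x 10 && x 11)) (x 2 && x 12)))
          (xor
            (xor (x 5 && x 12) (x 5 && (x 6 && x 12)))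
            (xor (x 5 && (x 8 && x 12)) (x 4 && (x 10 && x 12)))))
        (xor
          (xor (x 5 && (x 10 && x 12)) (xor (x 5 && (x 11 && x 12)) (x 9 && (x 11 && x 12))))
          (xor
            (xor (x 3 && x 13) (x 4 && x 13))
            (xor (x 0 && (x 6 && x 13)) (x 1 && (x 6 && x 13))))))
      (xor
        (xor
          (xor (x 2 && (x 6 && x 13)) (xor (x 4 && (x 6 && x 13)) (x 0 && (x 7 && x 13))))
          (xor
            (xor (x 5 && (x 7 && x 13)) (x 0 && (x 8 && x 13)))
            (xor (x 2 && (x 8 && x 13)) (x 0 && (x 9 && x 13)))))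
        (xor
          (xor (x 1 && (x 9 && x 13)) (xor (x 2 && (x 9 && x 13)) (x 4 && (x 9 && x 13))))
          (xor
            (xor (x 5 && (x 9 && x 13)) (x 5 && (x 10 && x 13)))
            (xor (x 4 && (x 11 && x 13)) (x 5 && (x 11 && x 13)))))))

/-- `gL` is cubic. [cite: Carlet2020, §2.2.1 Def. 6] -/
theorem isDegLeFun_gL : IsDegLeFun 3 gL := by
  unfold gL
  repeat (first
    | exact isDegLeFun_mon3 _ _ _
    | exact isDegLeFun_mon2 _ _
    | apply isDegLeFun_xor)

/-- The Walsh capacity of `gL` on codes: `Σ_y |W_gL(y)| = 1949696 = 119·2^14`. [folklore] -/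
theorem capList_gL : ((wal (7 + 7) (sigTable (7 + 7) gL)).map Int.natAbs).sum = 1949696 := by native_decide

/-- `W_gL(0) = 64` on codes (a level-6 coefficient: `64 ≢ 0 (mod 128)`). [folklore] -/
theorem walZero_gL : (wal (7 + 7) (sigTable (7 + 7) gL))[0]?.getD 0 = 64 := by native_decide

/-- `Σ_y |wspec gL y| = 1949696`. [folklore] -/
theorem sum_abs_wspec_gL : ∑ y ∈ range (2 ^ (7 + 7)), |wspec (7 + 7) gL y| = 1949696 := by
  have h := sum_abs_wspec_eq (7 + 7) gL
  rw [capList_gL] at h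
  exact_mod_cast h

/-- `wspec gL 0 = 64`. [folklore] -/
theorem wspec_gL_zero : wspec (7 + 7) gL 0 = 64 := by
  have h := wal_sigTable (7 + 7) gL 0 (by norm_num)
  rw [walZero_gL] at h
  exact h.symm

/-- `W_gL` takes the value `64` (at the point with code `0`): `gL` is neither bent nor of level `≥ 7`. [folklore] -/
theorem W_gL_at_zero : W (fun y => signOf (gL y)) (pt (7 + 7) 0) = 64 := by
  rw [W_pt, wspec_gL_zero]
  simp

/-- **`Σ_x |W_gL(x)| = (119/128)·2^21`.** [folklore] -/
theorem sum_abs_W_gL : ∑ x, |W (fun y => signOf (gL y)) x| = (119 / 128 : ℝ) * 2 ^ 21 := by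
  rw [sum_pt]
  simp_rw [W_pt]
  have h : ∑ k ∈ range (2 ^ (7 + 7)), |(wspec (7 + 7) gL k : ℝ)| =
      ((∑ y ∈ range (2 ^ (7 + 7)), |wspec (7 + 7) gL y| : ℤ) : ℝ) := by
    push_cast
    rfl
  rw [h, sum_abs_wspec_gL]
  norm_num

/-- **Level 6 of the `n = 14` tower is inhabited at capacity `119/128`**: a cubic with a Walsh coefficient equal to `64`
(so `≢ 0 mod 128`) whose Walsh capacity is exactly `(119/128)·2^21 > (57/64)·2^21`; hence `forrelation_le_cap` alone cannot
certify any level-6 isolation threshold below `119/128` at `n = 14`. [folklore] -/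
theorem levelSix_capacity_fourteen :
    ∃ g : (Fin (7 + 7) → Bool) → Bool, IsDegLeFun 3 g ∧ (∃ x, W (fun y => signOf (g y)) x = 64) ∧
      ∑ x, |W (fun y => signOf (g y)) x| = (119 / 128 : ℝ) * 2 ^ 21 :=
  ⟨gL, isDegLeFun_gL, ⟨_, W_gL_at_zero⟩, sum_abs_W_gL⟩

end Summit.QuantumAdvantage.QuantumAdvantage.Theorems.NearExactIsExact.Negative.LevelSixFourteen
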